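import Mathlib
import HarnessLib

/-!
# Tammes' problem for thirteen points (the strong thirteen spheres problem) — Musin–Tarasov 2012
(named fact, D-0014; topic `Literature/Geometry/DiscreteGeometry`, sibling of `KissingNumberThree.lean`)

O. R. Musin, A. S. Tarasov, *The strong thirteen spheres problem*, Discrete Comput. Geom. 48 (2012)
128–141, doi:10.1007/s00454-011-9392-2, arXiv:1002.1439 (held; pp. 3–4 read). With
`ψ(X) = min_{x ≠ y ∈ X} dist_{S²}(x,y)` (angular distance) and `d_N = max_{|X| = N} ψ(X)` (p. 3),
**Theorem 1** (p. 4): "The arrangement of 13 points in `S²` which is shown in Fig. 1 is the best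
possible, the maximal arrangement is unique up to isometry, and `d₁₃ = δ₁₃`", where
`δ₁₃ ≈ 57.1367°` (p. 3, Remark: "the value `d = δ₁₃` can be found analytically … `δ₁₃ ≈ 57.1367°`";
computer-assisted proof via irreducible contact graphs, Danzer flips and LP relaxation, §§3–5).
Earlier bounds quoted there: `d₁₃ < 60°` (⇔ `k(3) = 12`, Schütte–van der Waerden; tree
`musin2006_kissing_three`), Böröczky–Szabó `d₁₃ < 58.7°`, Bachoc–Vallentin `d₁₃ < 58.5°`.

Recorded, like `musin2006_kissing_three`, in CHORDAL form on finite sets of unit vectors of `ℝ³`,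
with a rational threshold strictly above the printed optimum: the chord of `δ₁₃` is
`2 sin(δ₁₃/2) = √(2 − 2 cos δ₁₃) = 0.95641…`, and we use `0.957` (an angular separation of
`57.17…°`, above `δ₁₃` with a margin of `0.04°` ≫ the printed rounding) — a consequence strictly
WEAKER than Theorem 1: thirteen unit vectors always contain two at distance `≤ 0.9565 < 0.957`, so a
set with all mutual distances `≥ 0.957` has at most twelve elements.

It grounds `Summit.AtomisticToContinuum.Crystallization.Theses.EnergyDerivativeOrder.GappedKissingBound`
(stmt-AtomisticToContinuum-12281: shell points within `1/400` of radius `1` with mutual distances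
`≥ 399/400` project to unit vectors at pairwise angle `≥ 59.67°`, chord `≥ 0.9949 > 0.957`, hence
at most `12` of them — the refuters' Tammes-13 argument, margin `59.67° − 57.14°`), and more generally
every "gapped kissing" count with angular tolerance below `2.5°`.

## References
* O. R. Musin, A. S. Tarasov, Discrete Comput. Geom. 48 (2012) 128–141, Theorem 1 and p. 3.
  [MusinTarasov2012]
* K. Böröczky, L. Szabó, *Arrangements of 13 points on a sphere*, in: Discrete Geometry (2003).
* L. Fejes Tóth, *Lagerungen in der Ebene, auf der Kugel und im Raum* (1953) (the `P₁₃`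
  arrangement).
-/

noncomputable section

namespace Literature.Geometry.DiscreteGeometry

open Finset

/-- **Tammes' problem for `N = 13` (Musin–Tarasov 2012, Theorem 1: `d₁₃ = δ₁₃ ≈ 57.1367°`), chordal
consequence.** Every finite set of unit vectors of `ℝ³` whose pairwise Euclidean distances are all
`≥ 0.957` (angular separation `≥ 57.17…° > δ₁₃`) has at most twelve elements. (Printed: for every
13-point `X ⊂ S²`, `ψ(X) ≤ d₁₃ = δ₁₃ ≈ 57.1367°`, i.e. two points at chord distance
`≤ 2 sin(δ₁₃/2) = 0.9564…`; the threshold `0.957` makes this a strictly weaker statement.) Grounds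
`Summit.AtomisticToContinuum.Crystallization.Theses.EnergyDerivativeOrder.GappedKissingBound`.
[cite: MusinTarasov2012, Theorem 1 (p. 4) and Remark p. 3 (δ₁₃ ≈ 57.1367°)] -/
def musinTarasov2012_tammes_thirteen : Prop :=
  ∀ T : Finset (EuclideanSpace ℝ (Fin 3)), (∀ v ∈ T, ‖v‖ = 1) →
    (∀ v ∈ T, ∀ w ∈ T, v ≠ w → (0.957 : ℝ) ≤ dist v w) → T.card ≤ 12

/-- The kissing bound is the special case of threshold `1 ≥ 0.957`: Tammes-13 implies
`musin2006_kissing_three`-shaped statements for every threshold `≥ 0.957`. [folklore] -/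
theorem card_le_twelve_of_tammes_thirteen (h : musinTarasov2012_tammes_thirteen)
    (T : Finset (EuclideanSpace ℝ (Fin 3))) (hT : ∀ v ∈ T, ‖v‖ = 1) {c : ℝ} (hc : (0.957 : ℝ) ≤ c)
    (hdist : ∀ v ∈ T, ∀ w ∈ T, v ≠ w → c ≤ dist v w) : T.card ≤ 12 :=
  h T hT fun v hv w hw hvw => hc.trans (hdist v hv w hw hvw)

end Literature.Geometry.DiscreteGeometry

end
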